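import Literature.NumberTheory.GelbartRogawski1991.UnitaryDualPairSplittingDatum
import Literature.NumberTheory.GelbartRogawski1991.UnitaryDualPairGramDiagonal
import Literature.NumberTheory.GelbartRogawski1991.LocalUnitarySplittingDatum
import Literature.NumberTheory.Weil1964.DoublingDiagonalPolarisation
import Literature.NumberTheory.Weil1964.AdelicMetaplecticRationalLift
import Literature.NumberTheory.Weil1964.AdelicMetaplecticScalarTwist
import Literature.NumberTheory.Weil1964.AdelicMetaplecticFinRep
import Literature.NumberTheory.Automorphic.UnitaryGroupDirectSum
import Literature.NumberTheory.Automorphic.UnitaryGroupRestrictedProduct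
import Literature.NumberTheory.Automorphic.UnitaryGroupArchimedean
import Literature.NumberTheory.Automorphic.UnitaryGroupAdelicProduct
import Literature.NumberTheory.Automorphic.UnitaryGroupPlaceInclusion
import Literature.NumberTheory.Automorphic.IdeleClassGroup
import Literature.NumberTheory.Automorphic.IdeleClassGroupProofs
import Literature.NumberTheory.GaloisRepresentations.HeckeCharacter
import HarnessLib

/-!
# [GelbartRogawski1991, Prop. 3.1.1] by DOUBLING — the global data, for a GENERAL quadratic extension `E/F`

THIS IS THE GENERAL-`(F, E, c)` TWIN of `DoubledUnitaryGlobalSplittingData` (which is the CM case `F = L⁺`, `E = L`,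
`c` = complex conjugation, diagonal real Gram data `dV, dW`): here `F` is ANY number field, `E/F` ANY quadratic extension with
non-trivial automorphism `c`, `δ ∈ E` any element with `c δ = -δ`, `δ ≠ 0`, `δ² = d ∈ F`, and the hermitian data are ARBITRARY
symmetric invertible matrices `TV ∈ M_N(F)`, `TW ∈ M_M(F)` (Gram matrices `J_V = TV ⊗ 1`, `J_W = TW ⊗ 1`); the datum is the
tree's general `UnitaryDualPair.splittingDatum F E c N M e (TV ⊗ 1) (TW ⊗ 1) …` (of which `cmSplittingDatum` is the CM instance,
`cmSplittingDatum_eq`).  Namespace `GRConstructionGen` (the CM file's `GRConstruction` is untouched).  Every definition and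
proof below is the CM file's, re-typed; the statement-exact typing `Prop311AsPrinted` quantifies over all such `E/F`, and this
is the first file of the construction side of that general case (programme note `GENERAL-EF-PLAN.md` of the GR lane).  In the
prose below read `L⁺ := F`, `L := E`.

Gelbart–Rogawski, *L-functions and Fourier–Jacobi coefficients for the unitary group U(3)*, Invent. Math. 105
(1991), §3.1 Prop. 3.1.1 p. 455 L1–2: for a unitary group `G = U(𝕍)` over a CM∕totally real pair `L ∕ L⁺` the
metaplectic cover of `Sp(Res_{L/L⁺} 𝕍)(𝔸)` splits over `G(𝔸)`, continuously, compatibly with Weil's rational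
section.  This file and its siblings give a KERNEL CONSTRUCTION of that splitting for the datum of record
`cmSplittingDatum L e dV … dW …` (`𝕍 = V ⊗_L W` with diagonal Gram matrices, `UnitaryDualPairThetaKernelCM`), whose
end theorem has literally the body of the abstract record `SplittingDatum.CompatibleSplitting`.  The route is
the DOUBLING METHOD [Kudla1994, §§1–3], [HarrisKudlaSweet1996, §1 (1.11)–(1.16), Cor. A.3] (Gelbart–Rogawski's own
proof, pp. 455–457, goes through Kazhdan's splitting over `SU` instead):

* `𝔻 := 𝕍 ⊕ (−𝕍)` (hermitian Gram `J ⊕ (−J)`), `H := U(𝔻)` — quasi-split, with SIEGEL PARABOLIC `P_Δ` = the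
  stabiliser of the diagonal `Δ = {(x, x)}`; `H(k)` is the normal closure of `P_Δ(k)` over every field `k ⊇ L⁺`;
* `𝕎^𝔻 := Res 𝔻 = 𝕎 ⊕ 𝕎⁻` with rational Gram `T^𝔻 = T ⊕ (−T)`; the tree's rational symplectic element
  `δ = deltaDiag` (`DoublingDiagonalPolarisation`) carries `Res Δ` onto the standard Lagrangian `𝕐`, so
  `δ ι(P_Δ) δ⁻¹ ⊆ P_𝕐`, whose implementers in the Schrödinger model are of EVALUATION FORM and hence pinned by their
  value-at-the-origin scalar;
* THE WEIL REPRESENTATION OF THE DOUBLED GROUP with Hecke character `χ` (`χ|_{𝕀_{L⁺}} = ε_{L/L⁺}`): a continuous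
  homomorphism `sD : H(𝔸) →* Mp(𝕎^𝔻)ᶜᵒⁿᵗ` over `ι^𝔻` whose value-at-0 scalar on `p ∈ P_Δ(𝔸)` is PRESCRIBED to be
  `χ(det_Δ p) |det_Δ p|_{𝔸_L}^{1/2}` ([HarrisKudlaSweet1996, §1 (1.15)]: `ω(m(a))φ(x) = χ(det a)|det a|^{m/2} φ(xa)`,
  `m = 1`) — the interface Prop `IsDoubledWeilRep χ sD` of §3, split into a finite half `IsFinHalf` and an
  archimedean half `IsArchHalf` (§4) which are assembled in `DoubledWeilRepresentationAssembly`;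
* rational clause (`DoubledWeilRepresentationRationalSchur`, `…RationalParabolic`): on `P_Δ(L⁺)` the prescription
  gives `sD = r_F^𝔻` (`χ|_{L^×} = 1`, product formula), and two homomorphisms over the same `ι^𝔻` differ by a
  central character, trivial on `P_Δ(L⁺)` hence on its normal closure `H(L⁺)` — NO product formula for Weil indices
  or cocycles is needed;
* undoubling (`DoubledWeilRepresentationUndoubling`): restrict to `U(𝕍) × 1 ⊂ H`, strip `⊗ 1`, and use Θ-rigidity
  on rational points.

Contents of THIS file (definitions with bodies and elementary theorems only; nothing is asserted):
§0 the Gram matrices `T`, `T^𝔻`, `T^𝔻 ⊗ 1`, `J^𝔻` and their units∕symmetry; §1 `H(𝔸)`, the Siegel predicate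
`IsSiegelDelta`, `det_Δ`, `H(L⁺)`, `U(𝕍) × 1 ↪ H` (`inlG`); §2 `Mp(𝕎^𝔻)ᶜᵒⁿᵗ`, `π`, `ι^𝔻`, `r_F^𝔻`, `δ`; §3 the
prescription (`chiDet`, `modDelta`, `opD`) and `IsDoubledWeilRep`; §3bis its local form `ParabolicNormalisedAt v`
(place inclusion `locToAdelic v`, `δ` read at `v`); §4 the halves `IsFinHalf`, `IsArchHalf` and the per-place
package `FinLocalFamily` (the `LocalSplittingDatum` of `LocalUnitarySplittingDatum` instantiated at the doubled
data); §5 joint injectivity of `(π, ω)` on `Mp(𝕎^𝔻)ᶜᵒⁿᵗ` and commutation of archimedean with finite operators.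

Design: every `def` has a body over existing tree declarations; the Gram matrices are plain `def`s (NOT `abbrev`:
reducible unfolding of `reindex ∘ fromBlocks ∘ gram ∘ map` inside `Sp(𝔸)`∕`Mp(𝔸)` types makes `isDefEq` time
out); algebra is proved over abstract groups and instantiated in one term where the concrete types are heavy.
-/

set_option autoImplicit false

noncomputable section

open scoped Classical
open scoped Matrix Kronecker TensorProduct
open NumberField IsDedekindDomain
open Literature.RepresentationTheory.HeisenbergGroup
open Literature.NumberTheory.Automorphic
open Literature.NumberTheory.Weil1964
open Literature.NumberTheory.GaloisRepresentations

namespace Literature.NumberTheory.GelbartRogawski1991.GRConstructionGen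

open UnitaryDualPair

variable (F : Type) [Field F] [NumberField F] (E : Type) [Field E] [NumberField E] [Algebra F E]
  [Algebra.IsQuadraticExtension F E]
variable (c : E ≃ₐ[F] E) {δ : E} (hcδ : c δ = -δ) (hδ : δ ≠ 0) {d : F} (hd : δ * δ = algebraMap F E d)
variable {N M n : ℕ} (e : Fin N × Fin M ≃ Fin n)
  (TV : Matrix (Fin N) (Fin N) F) (hV : TV.IsSymm) (hVd : IsUnit TV.det)
  (TW : Matrix (Fin M) (Fin M) F) (hW : TW.IsSymm) (hWd : IsUnit TW.det)

/-! ## §0 The data of record, abbreviated; the doubled data at index `Fin (n + n)` -/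

/-- `T ∈ M_n(L⁺)`: the RATIONAL Gram matrix of `𝕎 = Res(V ⊗ W)` (`reindex e e (realDiag dV ⊗ realDiag dW)`; the datum's
adelic Gram `adelicGram` is `T ⊗ 1`, `adelicGram_eq_map`).
[cite: GelbartRogawski1991, §3.1 Prop. 3.1.1 p. 455 L1–2] -/
def gramR : Matrix (Fin n) (Fin n) F := gram F e (TV) (TW)

/-- the re-enumeration `Fin n ⊕ Fin n ≃ Fin (n + n)` used throughout for the doubled space (so that the unitary-side
factorisation API `UnitaryGroup.adelic ∕ finAdelic ∕ localPi ∕ finAdelicEquiv ∕ localPiToSymplectic`, typed over `Fin N`,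
applies with `N := n + n`). [cite: GelbartRogawski1991, §3.1 Prop. 3.1.1 p. 455 L1–2] -/
abbrev e₂ : Fin n ⊕ Fin n ≃ Fin (n + n) := finSumFinEquiv

/-- **`T^𝔻 = T ⊕ (−T) ∈ M_{n+n}(L⁺)`**: the rational Gram matrix of the DOUBLED symplectic space `𝕎^𝔻 = 𝕎 ⊕ 𝕎⁻`
(tree convention `fromBlocks T 0 0 (−T)` of `DoublingDiagonalPolarisation`, re-enumerated by `e₂`).
[cite: GelbartRogawski1991, §3.1 Prop. 3.1.1 p. 455 L1–2] -/
def gramD : Matrix (Fin (n + n)) (Fin (n + n)) F :=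
  Matrix.reindex (e₂ (n := n)) (e₂ (n := n)) (Matrix.fromBlocks (gramR F e TV TW) 0 0 (-gramR F e TV TW))

/-- `T^𝔻 ⊗ 1 ∈ M_{n+n}(𝔸_{L⁺})`. [cite: GelbartRogawski1991, §3.1 Prop. 3.1.1 p. 455 L1–2] -/
def gramDA : Matrix (Fin (n + n)) (Fin (n + n)) (AdeleRing (𝓞 F) F) :=
  (gramD F e TV TW).map (algebraMap F (AdeleRing (𝓞 F) F))

/-- **`J^𝔻 := T^𝔻 ⊗_{L⁺} L ∈ M_{n+n}(L)`**, the hermitian Gram matrix of the doubled space `𝔻 = 𝕍 ⊕ (−𝕍)`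
(`= reindex e₂ e₂ (J ⊕ (−J))`, `J = reindex e e (diag dV ⊗ diag dW)`, by `realDiagonal_map`).
[cite: GelbartRogawski1991, §3.1 Prop. 3.1.1 p. 455 L1–2] -/
def hermD : Matrix (Fin (n + n)) (Fin (n + n)) E := (gramD F e TV TW).map (algebraMap F E)

omit [NumberField F] in
include hV hW in
/-- `T^𝔻` is symmetric (blocks of the symmetric `T`;
`isUnit_det_fromBlocks_neg`, `isUnit_det_gram`). [cite: GelbartRogawski1991, §3.1 Prop. 3.1.1 p. 455 L1–2] -/
theorem gramD_isSymm : (gramD F e TV TW).IsSymm := by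
  have hT : (gramR F e TV TW).IsSymm := by
    show (Matrix.reindex e e _).IsSymm
    exact (UnitaryGroup.isSymm_kronecker (hV) (hW)).submatrix _
  show (Matrix.reindex _ _ (Matrix.fromBlocks _ _ _ _)).IsSymm
  exact (Matrix.isSymm_fromBlocks_iff.2 ⟨hT, by simp, by simp, hT.neg⟩).submatrix _

omit [NumberField F] in
include hVd hWd in
/-- `det T^𝔻` is a unit. [cite: GelbartRogawski1991, §3.1 Prop. 3.1.1 p. 455 L1–2] -/
theorem isUnit_det_gramD : IsUnit (gramD F e TV TW).det := by
  rw [gramD, Matrix.det_reindex_self]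
  exact isUnit_det_fromBlocks_neg _
    (isUnit_det_gram F e hVd hWd)

include hVd hWd in
/-- `det (T^𝔻 ⊗ 1)` is a unit. [cite: GelbartRogawski1991, §3.1 Prop. 3.1.1 p. 455 L1–2] -/
theorem isUnit_det_gramDA : IsUnit (gramDA F e TV TW).det := by
  rw [gramDA, ← RingHom.mapMatrix_apply, ← RingHom.map_det]
  exact (isUnit_det_gramD F e TV hVd TW hWd).map _

/-- the datum of record (display abbreviation). [cite: GelbartRogawski1991, §3.1 Prop. 3.1.1 p. 455 L1–2] -/
abbrev D := splittingDatum F E c N M e (TV.map (algebraMap F E)) (TW.map (algebraMap F E)) hcδ hδ hd hV hW hVd hWd rfl rfl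

/-! ## §1 The doubled unitary group `H(𝔸) = U(𝔻)(𝔸_{L⁺})`, its Siegel parabolic `P_Δ`, rational points, `U(𝕍) × 1 ↪ H` -/

/-- **`H(𝔸) = U(J^𝔻)(𝔸_{L⁺}) ≤ GL_{n+n}(𝔸_L)`** — the tree's `UnitaryGroup.adelic` (so that `UnitaryGroup.finAdelicEquiv`:
`H(𝔸_f) ≃ₜ* Π'_v H(L⁺_v)` and `localPiToSymplectic` apply verbatim with `N := n + n`, `J := J^𝔻`).
[cite: GelbartRogawski1991, §3.1 Prop. 3.1.1 p. 455 L1–2] -/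
abbrev HA : Subgroup (GL (Fin (n + n)) (AdeleRing (𝓞 E) E)) :=
  UnitaryGroup.adelic F E c (n + n) (hermD F E e TV TW)

/-- the matrix of `h ∈ H(𝔸)` in the block enumeration `Fin n ⊕ Fin n` (`𝔻 = 𝕍 ⊕ 𝕍`).
[cite: GelbartRogawski1991, §3.1 Prop. 3.1.1 p. 455 L1–2] -/
abbrev blk (h : HA F E c e TV TW) : Matrix (Fin n ⊕ Fin n) (Fin n ⊕ Fin n) (AdeleRing (𝓞 E) E) :=
  Matrix.reindex (e₂ (n := n)).symm (e₂ (n := n)).symm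
    ((h : GL (Fin (n + n)) (AdeleRing (𝓞 E) E)) : Matrix (Fin (n + n)) (Fin (n + n)) (AdeleRing (𝓞 E) E))

/-- **`h ∈ P_Δ(𝔸)`**: `h` stabilises the diagonal `Δ = {(x, x)}` of `𝔻 = 𝕍 ⊕ 𝕍`, i.e. `h (x, x) = (y, y)`:
the two block-row sums agree, `h₁₁ + h₁₂ = h₂₁ + h₂₂`. [cite: GelbartRogawski1991, §3.1 Prop. 3.1.1 p. 455 L1–2] -/
def IsSiegelDelta (h : HA F E c e TV TW) : Prop :=
  (blk F E c e TV TW h).toBlocks₁₁ + (blk F E c e TV TW h).toBlocks₁₂ =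
    (blk F E c e TV TW h).toBlocks₂₁ + (blk F E c e TV TW h).toBlocks₂₂

/-- the action of `h ∈ P_Δ(𝔸)` on `Δ ≅ 𝔸_Lⁿ`: the matrix `h₁₁ + h₁₂`.
[cite: GelbartRogawski1991, §3.1 Prop. 3.1.1 p. 455 L1–2] -/
def deltaBlock (h : HA F E c e TV TW) : Matrix (Fin n) (Fin n) (AdeleRing (𝓞 E) E) :=
  (blk F E c e TV TW h).toBlocks₁₁ + (blk F E c e TV TW h).toBlocks₁₂

/-- `det_Δ h := det (h|_Δ) ∈ 𝔸_L` (a unit for `h ∈ P_Δ(𝔸)`; Kudla's `x(p)` on the Siegel parabolic of the doubled group).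
[cite: GelbartRogawski1991, §3.1 Prop. 3.1.1 p. 455 L1–2] -/
def detDelta (h : HA F E c e TV TW) : AdeleRing (𝓞 E) E := (deltaBlock F E c e TV TW h).det

/-- the rational points `H(L⁺) ≤ H(𝔸)` (range of the tree's `UnitaryGroup.toAdelic`).
[cite: GelbartRogawski1991, §3.1 Prop. 3.1.1 p. 455 L1–2] -/
abbrev ratH : Subgroup (HA F E c e TV TW) :=
  (UnitaryGroup.toAdelic F E c (n + n) (hermD F E e TV TW)).range

/-- the adelic form of the datum's pair: `(diag dV ⊗ 1) ⊗ₖ (diag dW ⊗ 1)` on `Fin N × Fin M`.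
[cite: GelbartRogawski1991, §3.1 Prop. 3.1.1 p. 455 L1–2] -/
abbrev pairFormA : Matrix (Fin N × Fin M) (Fin N × Fin M) (AdeleRing (𝓞 E) E) :=
  UnitaryGroup.adelicForm E N (TV.map (algebraMap F E)) ⊗ₖ UnitaryGroup.adelicForm E M (TW.map (algebraMap F E))

omit [Algebra.IsQuadraticExtension F E] in
/-- the doubled adelic form is the re-enumerated block form `J_𝔸 ⊕ (−J_𝔸)`.
[cite: GelbartRogawski1991, §3.1 Prop. 3.1.1 p. 455 L1–2] -/
theorem adelicForm_hermD_eq :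
    UnitaryGroup.adelicForm E (n + n) (hermD F E e TV TW) =
      Matrix.reindex (e₂ (n := n)) (e₂ (n := n))
        (Matrix.fromBlocks (Matrix.reindex e e (pairFormA F E TV TW)) 0 0 (-Matrix.reindex e e (pairFormA F E TV TW))) := by
  have hP : pairFormA F E TV TW =
      ((TV ⊗ₖ TW).map (algebraMap F E)).map (algebraMap E (AdeleRing (𝓞 E) E)) := by
    rw [← UnitaryGroup.kronecker_map_map]
    exact UnitaryGroup.kronecker_map_map _ _ _
  set f : F → AdeleRing (𝓞 E) E := ⇑(algebraMap E (AdeleRing (𝓞 E) E)) ∘ ⇑(algebraMap F E) with hf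
  have hf0 : f 0 = 0 := by simp [hf]
  have hfn : ∀ a, f (-a) = -f a := fun a => by simp [hf]
  unfold UnitaryGroup.adelicForm hermD gramD gramR gram
  rw [hP, Matrix.map_map, Matrix.map_map, ← hf]
  simp only [Matrix.reindex_apply, ← Matrix.submatrix_map, Matrix.fromBlocks_map, Matrix.map_zero f hf0,
    Matrix.map_neg f hfn]

/-- **`U(𝕍)(𝔸) × 1 ↪ H(𝔸)`**, `g ↦ g ⊕ 1` on `G₁(𝔸) = adelicPair … (diag dV) (diag dW)` (index `Fin N × Fin M`,
re-enumerated by `e`, then placed as the first diagonal block and re-enumerated by `e₂`) — a composite of the tree's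
`UnitaryGroup.reindexU` and `UnitaryGroup.blockDiag`, cast along `adelicForm_hermD_eq`.
[cite: GelbartRogawski1991, §3.1 Prop. 3.1.1 p. 455 L1–2] -/
def inlG : UnitaryGroup.adelicPair F E c N M (TV.map (algebraMap F E)) (TW.map (algebraMap F E)) →*
    HA F E c e TV TW :=
  (Subgroup.inclusion (le_of_eq (congrArg (unitaryGroupOfForm (UnitaryGroup.conjAdele F E c))
      (adelicForm_hermD_eq F E e TV TW).symm))).comp <|
    (UnitaryGroup.reindexU _ (e₂ (n := n)) _).comp <|
      (UnitaryGroup.blockDiag _ _ _).comp <|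
        (MonoidHom.prod ((UnitaryGroup.reindexU _ e _)) 1)

/-! ## §2 The doubled symplectic side: `Sp(𝕎^𝔻)`, `Mp(𝕎^𝔻)ᶜᵒⁿᵗ`, `ι^𝔻`, `r_F^𝔻`, `δ` -/

/-- `Mp(𝕎^𝔻)ᶜᵒⁿᵗ` — the metaplectic group of record of the DOUBLED space (same construction as the datum's `Mp`).
[cite: GelbartRogawski1991, §3.1 Prop. 3.1.1 p. 455 L1–2] -/
abbrev MpD := adelicMpCont F (Fin (n + n)) (gramDA F e TV TW)

/-- `π` on `Mp(𝕎^𝔻)ᶜᵒⁿᵗ`. [cite: GelbartRogawski1991, §3.1 Prop. 3.1.1 p. 455 L1–2] -/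
abbrev projD : MpD F e TV TW →* symplecticGroup (polar (adelicForm F (Fin (n + n)) (gramDA F e TV TW))) :=
  adelicMpCont.proj F (Fin (n + n)) (gramDA F e TV TW)

/-- **`ι^𝔻 : H(𝔸) →* Sp(𝕎^𝔻_𝔸)`**, restriction of scalars `L → L⁺` for the doubled hermitian space — the tree's
`UnitaryGroup.adelicToSymplectic` at `N := n + n`, `T := T^𝔻`, `J := J^𝔻 = T^𝔻 ⊗ L` (`hJ := rfl`).
[cite: GelbartRogawski1991, §3.1 Prop. 3.1.1 p. 455 L1–2] -/
def toSpD : HA F E c e TV TW →* symplecticGroup (polar (adelicForm F (Fin (n + n)) (gramDA F e TV TW))) :=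
  UnitaryGroup.adelicToSymplectic F E c (n + n) hcδ hδ
    hd (gramD_isSymm F e TV hV TW hW) rfl

/-- **`r_F^𝔻 : Sp_{2(n+n)}(L⁺) →* Mp(𝕎^𝔻)ᶜᵒⁿᵗ`** — Weil's Θ-rigid rational section of the doubled space.
[cite: GelbartRogawski1991, §3.1 Prop. 3.1.1 p. 455 L1–2] -/
abbrev rFD : Matrix.symplecticGroup (Fin (n + n)) F →* MpD F e TV TW :=
  ratThetaLiftCont F (gramDA F e TV TW) (isUnit_det_gramDA F e TV hVd TW hWd)

omit [NumberField F] in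
/-- re-enumerating Mathlib's symplectic matrices along `e₂ ⊕ e₂` (`J_l` is block-natural).
[cite: GelbartRogawski1991, §3.1 Prop. 3.1.1 p. 455 L1–2] -/
theorem reindex_deltaDiag_mem_symplecticGroup :
    Matrix.reindex ((e₂ (n := n)).sumCongr (e₂ (n := n))) ((e₂ (n := n)).sumCongr (e₂ (n := n)))
        (deltaDiagMatrix F (Fin n)) ∈ Matrix.symplecticGroup (Fin (n + n)) F := by
  have h := deltaDiagMatrix_mem F (Fin n)
  rw [SymplecticGroup.mem_iff] at h ⊢
  have hJ : Matrix.J (Fin (n + n)) F =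
      Matrix.reindex ((e₂ (n := n)).sumCongr (e₂ (n := n))) ((e₂ (n := n)).sumCongr (e₂ (n := n)))
        (Matrix.J (Fin n ⊕ Fin n) F) := by
    ext i j
    rcases i with i | i <;> rcases j with j | j <;>
      simp [Matrix.J, Matrix.fromBlocks, Matrix.one_apply, (e₂ (n := n)).symm.injective.eq_iff]
  rw [hJ, Matrix.reindex_apply, Matrix.reindex_apply, Matrix.transpose_submatrix, Matrix.submatrix_mul_equiv,
    Matrix.submatrix_mul_equiv, h]

/-- **`δ ∈ Sp(𝕎^𝔻)(L⁺)`**: the tree's RATIONAL symplectic element `deltaDiag` carrying `Res Δ` onto the standard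
Lagrangian `𝕐` (`transportSp_deltaDiag_diag`), re-enumerated by `e₂`.
[cite: GelbartRogawski1991, §3.1 Prop. 3.1.1 p. 455 L1–2] -/
def deltaD : Matrix.symplecticGroup (Fin (n + n)) F :=
  ⟨_, reindex_deltaDiag_mem_symplecticGroup F⟩

/-- `r_F^𝔻(δ) ∈ Mp(𝕎^𝔻)ᶜᵒⁿᵗ`. [cite: GelbartRogawski1991, §3.1 Prop. 3.1.1 p. 455 L1–2] -/
abbrev rDelta : MpD F e TV TW := rFD F e TV hVd TW hWd (deltaD F)

/-! ## §3 The PRESCRIPTION on the Siegel parabolic and the interface Prop `IsDoubledWeilRep χ sD`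

No operator data is introduced: an implementer `M` of an element of the standard Siegel parabolic `P_𝕐` (stabiliser of
the Lagrangian `𝕐 = {0} × 𝔸^{n⊕n}`; functions live on `𝕏`) is of "evaluation form" `(M Φ)(x) = c · ψ(q(x)) · Φ(A x)`, so
it is PINNED by the one scalar `(M Φ)(0) ∕ Φ(0) = c`.  For `p ∈ P_Δ(𝔸)`, `δ ι^𝔻(p) δ⁻¹ ∈ P_𝕐(𝔸)`
(`transportSp_deltaDiag_diag`), and the Weil representation of the doubled group with character `χ` has there
`c = χ(det_Δ p) · |det_Δ p|_{𝔸_L}^{1/2}` ([HarrisKudlaSweet1996, §1: `ω(m(a))φ(x) = χ(det a)|det a|^{m/2} φ(xa)`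
with `m = dim` of the partner line `= 1`]; the modulus is forced by unitarity ∕ extendability to `H(𝔸)`, the
character `χ` is the CHOICE that makes the extension exist, `χ|_{𝕀_{L⁺}} = ε_{L/L⁺}`). -/

/-- `χ(det_Δ p)` for a Hecke character `χ` of `L` (`HeckeCharacter E` = continuous characters of `𝕀_L = 𝔸_L^×` trivial
on `L^×`), read at the idele `det_Δ p` (a unit for `p ∈ P_Δ(𝔸)`; total definition, value `1` off units).
[cite: GelbartRogawski1991, §3.1 Prop. 3.1.1 p. 455 L1–2] -/
def chiDet (χ : HeckeCharacter E) (p : HA F E c e TV TW) : ℂˣ :=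
  if hu : IsUnit (detDelta F E c e TV TW p) then χ hu.unit else 1

/-- `|det_Δ p|_{𝔸_L}^{1/2}` (idelic norm; `1` off units). [cite: GelbartRogawski1991, §3.1 Prop. 3.1.1 p. 455 L1–2] -/
def modDelta (p : HA F E c e TV TW) : ℝ :=
  if hu : IsUnit (detDelta F E c e TV TW p) then Real.sqrt (ideleNorm hu.unit) else 1

/-- the Weil operator of `q ∈ Mp(𝕎^𝔻)ᶜᵒⁿᵗ` on `Φ ∈ 𝒮(𝔸_{L⁺}^{n⊕n})`, as a function.
[cite: GelbartRogawski1991, §3.1 Prop. 3.1.1 p. 455 L1–2] -/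
abbrev opD (q : MpD F e TV TW) (Φ : piSchwartzBruhat F (Fin (n + n))) :
    (Fin (n + n) → AdeleRing (𝓞 F) F) → ℂ :=
  ((adelicMpCont.omega F (Fin (n + n)) (gramDA F e TV TW) q Φ : piSchwartzBruhat F (Fin (n + n))) :
    (Fin (n + n) → AdeleRing (𝓞 F) F) → ℂ)

/-- **THE INTERFACE PROP.**  `sD` is "the Weil representation of the doubled group `H = U(𝕍 ⊕ −𝕍)` with
character `χ`": a homomorphism `H(𝔸) →* Mp(𝕎^𝔻)ᶜᵒⁿᵗ`, CONTINUOUS, over `ι^𝔻`, with the PRESCRIBED NORMALISATION on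
the Siegel parabolic `P_Δ(𝔸)`: the implementer `r_F^𝔻(δ) · sD(p) · r_F^𝔻(δ)⁻¹` of `δ ι^𝔻(p) δ⁻¹ ∈ P_𝕐(𝔸)` has
value-at-the-origin scalar `χ(det_Δ p) |det_Δ p|_{𝔸_L}^{1/2}`.  Since `H(k)` is the normal closure of `P_Δ(k)`,
such an `sD` is UNIQUE (two candidates differ by a central character of `H(𝔸)` trivial on `P_Δ(𝔸)`), so the
existence statement is rigid; per place the same Prop (local field `k = L⁺_v`, local Schrödinger model) is the
finite (`IsFinHalf`, from `FinLocalFamily`) ∕ archimedean (`IsArchHalf`) input.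
[cite: GelbartRogawski1991, §3.1 Prop. 3.1.1 p. 455 L1–2] -/
structure IsDoubledWeilRep (χ : HeckeCharacter E) (sD : HA F E c e TV TW →* MpD F e TV TW) : Prop where
  /-- `sD` is continuous (weak topology of `Mp(𝕎^𝔻)ᶜᵒⁿᵗ`) -/
  continuous : Continuous sD
  /-- `π ∘ sD = ι^𝔻` -/
  proj_eq : ∀ h, projD F e TV TW (sD h) = toSpD F E c hcδ hδ hd e TV hV TW hW h
  /-- the parabolic normalisation on `P_Δ(𝔸)` -/
  parabolic : ∀ (p : HA F E c e TV TW), IsSiegelDelta F E c e TV TW p → IsUnit (detDelta F E c e TV TW p) →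
    ∀ Φ : piSchwartzBruhat F (Fin (n + n)),
      opD F e TV TW (rDelta F e TV hVd TW hWd * sD p * (rDelta F e TV hVd TW hWd)⁻¹) Φ 0 =
        ((chiDet F E c e TV TW χ p : ℂˣ) : ℂ) * (modDelta F E c e TV TW p : ℂ) *
          (Φ : (Fin (n + n) → AdeleRing (𝓞 F) F) → ℂ) 0

/-! ## §3bis The LOCAL form of the parabolic normalisation (the field of the per-place package at the doubled data)

Stated WITHOUT local-component vocabulary: a local element `p ∈ H(L⁺_v)` is read in `H(𝔸)` through the place-`v`
inclusion `locToAdelic v` (Mathlib `RestrictedProduct.mulSingle` + tree `UnitaryGroup.finAdelicEquiv` + `finAdelicToAdelic`),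
and the prescribed scalar is the GLOBAL `χ(det_Δ ·) |det_Δ ·|_{𝔸_L}^{1/2}` at that adelic element (all other components
are `1`).  The local Weil data enter only through `ω_v` (= `(𝓓 v).localOmega`) and one implementer `M_δ` of the
rational `δ` read at `v` (= `(𝓓 v).r (deltaLoc v)`). -/

section Local

variable (v : HeightOneSpectrum (𝓞 F))

/-- the place-`v` inclusion `H(L⁺_v) →* H(𝔸)`: `p ↦ (1, …, p, …, 1)` (finite part) with trivial archimedean part —
the TREE's named inclusion `UnitaryGroup.inclPlaceAdelic` (component API `evalPlace_inclPlace`,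
`evalPlace_inclPlace_of_ne`, `exists_eq_mul_inclPlace`, `archPart_inclPlaceAdelic`, `finPart_inclPlaceAdelic`, …).
[cite: GelbartRogawski1991, §3.1 Prop. 3.1.1 p. 455 L1–2] -/
def locToAdelic :
    UnitaryGroup.localPi E c (n + n) (hermD F E e TV TW) v →* HA F E c e TV TW :=
  UnitaryGroup.inclPlaceAdelic F E c (n + n) (hermD F E e TV TW) v

/-- the local Gram matrix `T^𝔻 ⊗ L⁺_v`. [cite: GelbartRogawski1991, §3.1 Prop. 3.1.1 p. 455 L1–2] -/
abbrev gramDLoc : Matrix (Fin (n + n)) (Fin (n + n)) (v.adicCompletion F) :=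
  (gramD F e TV TW).map (algebraMap F (v.adicCompletion F))

include hVd hWd in
/-- `det (T^𝔻 ⊗ L⁺_v)` is a unit. [cite: GelbartRogawski1991, §3.1 Prop. 3.1.1 p. 455 L1–2] -/
theorem isUnit_det_gramDLoc : IsUnit (gramDLoc F e TV TW v).det := by
  rw [gramDLoc, ← RingHom.mapMatrix_apply, ← RingHom.map_det]
  exact (isUnit_det_gramD F e TV hVd TW hWd).map _

/-- **`δ` read at `v`**: the rational symplectic element `δ` in the local symplectic group `Sp(𝕎^𝔻_v)` (= the local package's `LocalSp`,
the codomain of `UnitaryGroup.localPiToSymplectic v`). [cite: GelbartRogawski1991, §3.1 Prop. 3.1.1 p. 455 L1–2] -/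
def deltaLoc : symplecticGroup (polar (Matrix.toLinearMap₂' (v.adicCompletion F) (gramDLoc F e TV TW v))) :=
  SymplecticMatrix.transportSp (gramDLoc F e TV TW v) (isUnit_det_gramDLoc F e TV hVd TW hWd v)
    (SymplecticMatrix.mapHom (algebraMap F (v.adicCompletion F)) (deltaD F))

/-- **`ParabolicNormalisedAt v χ ω_v M_δ`** — THE LOCAL PARABOLIC NORMALISATION at the finite place `v` (stated per place for `ω_v := (𝓓 v).localOmega`, `M_δ := (𝓓 v).r (deltaLoc v)` at the doubled datum, Lagrangian
`ℓ := δ⁻¹(0 × Y)`; for Kudla's `β` it holds ON THE NOSE: `j(p) = 0`, `x(p) = det_Δ p` on `P_Δ`):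
for `p ∈ P_Δ(L⁺_v)` (read adelically) and every `Φ ∈ 𝒮((L⁺_v)^{n+n})`,
`(M_δ (ω_v(p) (M_δ⁻¹ Φ)))(0) = χ(det_Δ p̂) · |det_Δ p̂|_{𝔸_L}^{1/2} · Φ(0)`, `p̂ = locToAdelic v p`.
[cite: GelbartRogawski1991, §3.1 Prop. 3.1.1 p. 455 L1–2] -/
def ParabolicNormalisedAt (χ : HeckeCharacter E)
    (ω : Representation ℂ (UnitaryGroup.localPi E c (n + n) (hermD F E e TV TW) v)
      (SchwartzBruhat (Fin (n + n) → v.adicCompletion F)))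
    (Mδ : SchwartzBruhat (Fin (n + n) → v.adicCompletion F) ≃ₗ[ℂ]
      SchwartzBruhat (Fin (n + n) → v.adicCompletion F)) : Prop :=
  ∀ p : UnitaryGroup.localPi E c (n + n) (hermD F E e TV TW) v,
    IsSiegelDelta F E c e TV TW (locToAdelic F E c e TV TW v p) →
    IsUnit (detDelta F E c e TV TW (locToAdelic F E c e TV TW v p)) →
    ∀ Φ : SchwartzBruhat (Fin (n + n) → v.adicCompletion F),
      ((Mδ (ω p (Mδ.symm Φ)) : SchwartzBruhat (Fin (n + n) → v.adicCompletion F)) :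
          (Fin (n + n) → v.adicCompletion F) → ℂ) 0 =
        ((chiDet F E c e TV TW χ (locToAdelic F E c e TV TW v p) : ℂˣ) : ℂ) *
          (modDelta F E c e TV TW (locToAdelic F E c e TV TW v p) : ℂ) *
          ((Φ : SchwartzBruhat (Fin (n + n) → v.adicCompletion F)) : (Fin (n + n) → v.adicCompletion F) → ℂ) 0

end Local

/-! ## §4 The two adelic halves of the doubled Weil representation and the per-place package

Both halves are stated with the SAME adelic vocabulary (`H(𝔸)`, `ι^𝔻`, `P_Δ`, `χ(det_Δ ·)`, `|det_Δ ·|`), through the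
tree's inclusions `UnitaryGroup.finAdelicToAdelic : H(𝔸_f) →* H(𝔸)` and `UnitaryGroup.archToAdelic : H(L⁺ ⊗ ℝ) →* H(𝔸)`;
an operator is FINITE if it is `1 ⊗ B`, ARCHIMEDEAN if it is `A ⊗ 1` on `𝒮(𝔸^{n+n}) = 𝓢 ⊗ 𝒮_f` (`adelicTensorEnd`). -/

/-- the parabolic prescription for a partial splitting `s : G →* Mp(𝕎^𝔻)ᶜᵒⁿᵗ` along `j : G →* H(𝔸)`.
[cite: GelbartRogawski1991, §3.1 Prop. 3.1.1 p. 455 L1–2] -/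
def ParabolicPrescribed {G : Type*} [Group G] (j : G →* HA F E c e TV TW) (χ : HeckeCharacter E)
    (s : G →* MpD F e TV TW) : Prop :=
  ∀ g : G, IsSiegelDelta F E c e TV TW (j g) → IsUnit (detDelta F E c e TV TW (j g)) →
    ∀ Φ : piSchwartzBruhat F (Fin (n + n)),
      opD F e TV TW (rDelta F e TV hVd TW hWd * s g * (rDelta F e TV hVd TW hWd)⁻¹) Φ 0 =
        ((chiDet F E c e TV TW χ (j g) : ℂˣ) : ℂ) * (modDelta F E c e TV TW (j g) : ℂ) *
          (Φ : (Fin (n + n) → AdeleRing (𝓞 F) F) → ℂ) 0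

/-- **the FINITE half** (assembled over the finite places by `finiteAdelePullback` from the family
`𝓓 v : LocalSplittingDatum … (n+n) … v μ_v ℓ_v hℓ_v` with `ParabolicNormalisedAt v χ (𝓓 v).localOmega ((𝓓 v).r (deltaLoc v))`
and the unramified clause a.e.): `sf : H(𝔸_f) →* Mp(𝕎^𝔻)ᶜᵒⁿᵗ` over `ι^𝔻`, continuous (restricted-product topology), by FINITE
operators, parabolic-prescribed on `P_Δ(𝔸_f)`. [cite: GelbartRogawski1991, §3.1 Prop. 3.1.1 p. 455 L1–2] -/
structure IsFinHalf (χ : HeckeCharacter E)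
    (sf : UnitaryGroup.finAdelic F E c (n + n) (hermD F E e TV TW) →*
      MpD F e TV TW) : Prop where
  /-- continuity -/
  continuous : Continuous sf
  /-- `π ∘ s = ι^𝔻 ∘ j` -/
  proj_eq : ∀ g, projD F e TV TW (sf g) = toSpD F E c hcδ hδ hd e TV hV TW hW
    (UnitaryGroup.finAdelicToAdelic F E c (n + n) (hermD F E e TV TW) g)
  /-- the operators are finite: `1 ⊗ B` -/
  isFinite : ∀ g, ∃ B : FinSB F (Fin (n + n)) →ₗ[ℂ] FinSB F (Fin (n + n)),
    (adelicMpCont.omega F (Fin (n + n)) (gramDA F e TV TW) (sf g) :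
        piSchwartzBruhat F (Fin (n + n)) →ₗ[ℂ] piSchwartzBruhat F (Fin (n + n))) =
      adelicTensorEnd LinearMap.id B
  /-- the parabolic prescription on `P_Δ(𝔸_f)` -/
  parabolic : ParabolicPrescribed F E c e TV hVd TW hWd
    (UnitaryGroup.finAdelicToAdelic F E c (n + n) (hermD F E e TV TW)) χ sf

/-- **the ARCHIMEDEAN half**: `s∞ : H(L⁺ ⊗ ℝ) →* Mp(𝕎^𝔻)ᶜᵒⁿᵗ` over `ι^𝔻`, continuous, by ARCHIMEDEAN operators
(`A ⊗ 1` with `A` a topological automorphism of `𝓢`; cf. `AdelicMetaplecticArchRep.archRepMp`, `IsArchWeilDatum`),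
parabolic-prescribed on `P_Δ(L⁺ ⊗ ℝ)` (existence only; no closed form off `P_Δ`).
[cite: GelbartRogawski1991, §3.1 Prop. 3.1.1 p. 455 L1–2] -/
structure IsArchHalf (χ : HeckeCharacter E)
    (sa : UnitaryGroup.arch F E c (n + n) (hermD F E e TV TW) →*
      MpD F e TV TW) : Prop where
  /-- continuity -/
  continuous : Continuous sa
  /-- `π ∘ s = ι^𝔻 ∘ j` -/
  proj_eq : ∀ g, projD F e TV TW (sa g) = toSpD F E c hcδ hδ hd e TV hV TW hW
    (UnitaryGroup.archToAdelic F E c (n + n) (hermD F E e TV TW) g)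
  /-- the operators are archimedean: `A ⊗ 1` -/
  isArch : ∀ g, ∃ A : SchwartzMap (Fin (n + n) → mixedEmbedding.mixedSpace F) ℂ →L[ℂ]
      SchwartzMap (Fin (n + n) → mixedEmbedding.mixedSpace F) ℂ,
    (adelicMpCont.omega F (Fin (n + n)) (gramDA F e TV TW) (sa g) :
        piSchwartzBruhat F (Fin (n + n)) →ₗ[ℂ] piSchwartzBruhat F (Fin (n + n))) =
      adelicTensorEnd (A : SchwartzMap (Fin (n + n) → mixedEmbedding.mixedSpace F) ℂ →ₗ[ℂ]
        SchwartzMap (Fin (n + n) → mixedEmbedding.mixedSpace F) ℂ) LinearMap.id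
  /-- the parabolic prescription on `P_Δ(L⁺ ⊗ ℝ)` -/
  parabolic : ParabolicPrescribed F E c e TV hVd TW hWd
    (UnitaryGroup.archToAdelic F E c (n + n) (hermD F E e TV TW)) χ sa


/-! #### The per-place package: the tree's `LocalSplittingDatum` at the DOUBLED data -/

section PerPlace

open Literature.NumberTheory.GelbartRogawski1991.UnitaryDualPair.LocalSplitting MeasureTheory

/-- Haar data at a finite place (the tree's local files take `[MeasurableSpace] [BorelSpace] (μ) [IsAddHaarMeasure]` as
parameters; a family over all `v` is carried by this bundle).
[cite: GelbartRogawski1991, §3.1 Prop. 3.1.1 p. 455 L1–2] -/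
structure PlaceMeasure (v : HeightOneSpectrum (𝓞 F)) where
  /-- the σ-algebra (the Borel one) -/
  mS : MeasurableSpace (v.adicCompletion F)
  /-- it is the Borel σ-algebra -/
  isBorel : (letI := mS; BorelSpace (v.adicCompletion F))
  /-- a Haar measure -/
  μ : (letI := mS; MeasureTheory.Measure (v.adicCompletion F))
  /-- `μ` is an additive Haar measure -/
  isHaar : (letI := mS; μ.IsAddHaarMeasure)

include hVd hWd in
/-- **the tree's `LocalSplittingDatum` (`LocalUnitarySplittingDatum`) INSTANTIATED at the doubled data**
`(N, T, J) := (n+n, T^𝔻, J^𝔻)` (`hJ := rfl`), at the place `v`, Haar data `𝔪`, Lagrangian `ℓ` (`hℓ : ℓ^⊥ = ℓ`; the intended one is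
`δ⁻¹(0 × Y)`, for which Kudla's `β` splits the Leray cocycle on the nose).
[cite: GelbartRogawski1991, §3.1 Prop. 3.1.1 p. 455 L1–2] -/
def LocalDatumAt (v : HeightOneSpectrum (𝓞 F)) (𝔪 : PlaceMeasure F v)
    (ℓ : Submodule (v.adicCompletion F) ((Fin (n + n) → v.adicCompletion F) × (Fin (n + n) → v.adicCompletion F)))
    (hℓ : LinearMap.BilinForm.orthogonal (alt (polar (localPairing F (n + n) (gramD F e TV TW) v))) ℓ = ℓ) :
    Type := by
  letI := 𝔪.mS; haveI := 𝔪.isBorel; haveI := 𝔪.isHaar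
  exact LocalSplittingDatum F E c (n + n) hcδ hδ
    hd (gramD F e TV TW) (gramD_isSymm F e TV hV TW hW)
    (isUnit_det_gramD F e TV hVd TW hWd) (J := hermD F E e TV TW) rfl v 𝔪.μ ℓ hℓ

/-- the local Weil representation `ω_v` of the datum (`localOmega`, instances unbundled from `𝔪`).
[cite: GelbartRogawski1991, §3.1 Prop. 3.1.1 p. 455 L1–2] -/
def omegaAt {v : HeightOneSpectrum (𝓞 F)} {𝔪 : PlaceMeasure F v}
    {ℓ : Submodule (v.adicCompletion F) ((Fin (n + n) → v.adicCompletion F) × (Fin (n + n) → v.adicCompletion F))}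
    {hℓ : LinearMap.BilinForm.orthogonal (alt (polar (localPairing F (n + n) (gramD F e TV TW) v))) ℓ = ℓ}
    (𝓓 : LocalDatumAt F E c hcδ hδ hd e TV hV hVd TW hW hWd v 𝔪 ℓ hℓ) :
    Representation ℂ (UnitaryGroup.localPi E c (n + n) (hermD F E e TV TW) v)
      (SchwartzBruhat (Fin (n + n) → v.adicCompletion F)) := by
  letI := 𝔪.mS; haveI := 𝔪.isBorel; haveI := 𝔪.isHaar
  exact LocalSplittingDatum.localOmega 𝓓

/-- the implementer `M_δ := r_v(δ)` of the datum (the section `r` at `deltaLoc v`).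
[cite: GelbartRogawski1991, §3.1 Prop. 3.1.1 p. 455 L1–2] -/
def rDeltaAt {v : HeightOneSpectrum (𝓞 F)} {𝔪 : PlaceMeasure F v}
    {ℓ : Submodule (v.adicCompletion F) ((Fin (n + n) → v.adicCompletion F) × (Fin (n + n) → v.adicCompletion F))}
    {hℓ : LinearMap.BilinForm.orthogonal (alt (polar (localPairing F (n + n) (gramD F e TV TW) v))) ℓ = ℓ}
    (𝓓 : LocalDatumAt F E c hcδ hδ hd e TV hV hVd TW hW hWd v 𝔪 ℓ hℓ) :
    SchwartzBruhat (Fin (n + n) → v.adicCompletion F) ≃ₗ[ℂ] SchwartzBruhat (Fin (n + n) → v.adicCompletion F) := by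
  letI := 𝔪.mS; haveI := 𝔪.isBorel; haveI := 𝔪.isHaar
  exact LocalSplittingDatum.r 𝓓 (deltaLoc F e TV hVd TW hWd v)

/-- **the PER-PLACE package** (built in `LocalDoubledUnitary*` from Kudla's local splitting): at every finite place a Lagrangian, a datum, the
parabolic normalisation (field `parabolicNormalised`) — and the unramified clause for almost all `v`; packaged as ONE family.
[cite: GelbartRogawski1991, §3.1 Prop. 3.1.1 p. 455 L1–2] -/
structure FinLocalFamily (χ : HeckeCharacter E) (𝔪 : ∀ v, PlaceMeasure F v) where
  /-- the Lagrangian at `v` -/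
  ℓ : ∀ v : HeightOneSpectrum (𝓞 F),
    Submodule (v.adicCompletion F) ((Fin (n + n) → v.adicCompletion F) × (Fin (n + n) → v.adicCompletion F))
  /-- each `ℓ v` is Lagrangian -/
  hℓ : ∀ v, LinearMap.BilinForm.orthogonal (alt (polar (localPairing F (n + n) (gramD F e TV TW) v))) (ℓ v) = ℓ v
  /-- the local splitting datum at `v` -/
  𝓓 : ∀ v, LocalDatumAt F E c hcδ hδ hd e TV hV hVd TW hW hWd v (𝔪 v) (ℓ v) (hℓ v)
  /-- the local parabolic normalisation at every `v` -/
  parabolicNormalised : ∀ v, ParabolicNormalisedAt F E c e TV TW v χ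
    (omegaAt F E c hcδ hδ hd e TV hV hVd TW hW hWd (𝓓 v)) (rDeltaAt F E c hcδ hδ hd e TV hV hVd TW hW hWd (𝓓 v))
  /-- the unramified clause, for almost all `v` -/
  unramified : ∀ᶠ v in Filter.cofinite,
    ∀ k ∈ UnitaryGroup.localInt E c (n + n) (hermD F E e TV TW) v,
      omegaAt F E c hcδ hδ hd e TV hV hVd TW hW hWd (𝓓 v) k (unitVec F (Fin (n + n)) v) = unitVec F (Fin (n + n)) v


/-- Haar data exist at every place (Borel σ-algebra + Mathlib's `Measure.addHaar`).
[cite: GelbartRogawski1991, §3.1 Prop. 3.1.1 p. 455 L1–2] -/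
theorem nonempty_placeMeasure (v : HeightOneSpectrum (𝓞 F)) : Nonempty (PlaceMeasure F v) := by
  letI : MeasurableSpace (v.adicCompletion F) := borel _
  haveI : BorelSpace (v.adicCompletion F) := ⟨rfl⟩
  exact ⟨⟨_, inferInstance, MeasureTheory.Measure.addHaar, inferInstance⟩⟩

end PerPlace

/-! ## §5 `(π, ω)` are jointly injective on `Mp(𝕎^𝔻)ᶜᵒⁿᵗ`; archimedean and finite operators commute -/

/-- `π` and the operator map are jointly injective on `Mp(𝕎^𝔻)ᶜᵒⁿᵗ` (pairs).
[cite: GelbartRogawski1991, §3.1 Prop. 3.1.1 p. 455 L1–2] -/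
theorem eq_of_proj_eq_of_op_eq (x y : MpD F e TV TW) (h1 : projD F e TV TW x = projD F e TV TW y)
    (h2 : ((x : adelicMp F (Fin (n + n)) (gramDA F e TV TW)) :
        symplecticGroup (polar (adelicForm F (Fin (n + n)) (gramDA F e TV TW))) ×
          (piSchwartzBruhat F (Fin (n + n)) ≃ₗ[ℂ] piSchwartzBruhat F (Fin (n + n)))).2 =
      ((y : adelicMp F (Fin (n + n)) (gramDA F e TV TW)) :
        symplecticGroup (polar (adelicForm F (Fin (n + n)) (gramDA F e TV TW))) ×
          (piSchwartzBruhat F (Fin (n + n)) ≃ₗ[ℂ] piSchwartzBruhat F (Fin (n + n)))).2) : x = y :=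
  Subtype.ext (Subtype.ext (Prod.ext h1 h2))


/-- `ω(q)` as a linear map IS the operator component of the pair (definitional).
[cite: GelbartRogawski1991, §3.1 Prop. 3.1.1 p. 455 L1–2] -/
theorem omega_eq_toLinearMap (q : MpD F e TV TW) :
    adelicMpCont.omega F (Fin (n + n)) (gramDA F e TV TW) q =
      (((q : adelicMp F (Fin (n + n)) (gramDA F e TV TW)) :
        symplecticGroup (polar (adelicForm F (Fin (n + n)) (gramDA F e TV TW))) ×
          (piSchwartzBruhat F (Fin (n + n)) ≃ₗ[ℂ] piSchwartzBruhat F (Fin (n + n)))).2 :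
        piSchwartzBruhat F (Fin (n + n)) →ₗ[ℂ] piSchwartzBruhat F (Fin (n + n))) := rfl

set_option maxHeartbeats 1600000 in
/-- `(π, ω)` are jointly injective on `Mp(𝕎^𝔻)ᶜᵒⁿᵗ`. [cite: GelbartRogawski1991, §3.1 Prop. 3.1.1 p. 455 L1–2] -/
theorem eq_of_proj_eq_of_omega_eq (x y : MpD F e TV TW) (h1 : projD F e TV TW x = projD F e TV TW y)
    (h2 : adelicMpCont.omega F (Fin (n + n)) (gramDA F e TV TW) x =
      adelicMpCont.omega F (Fin (n + n)) (gramDA F e TV TW) y) : x = y := by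
  refine eq_of_proj_eq_of_op_eq F e TV TW x y h1 (LinearEquiv.ext fun f => ?_)
  have h3 := LinearMap.congr_fun h2 f
  rw [adelicMpCont.omega_apply, omegaPsi_apply, adelicMpCont.omega_apply, omegaPsi_apply] at h3
  exact h3

/-- `A ⊗ 1` and `1 ⊗ B` commute on `𝒮(𝔸^{n+n})`. [cite: GelbartRogawski1991, §3.1 Prop. 3.1.1 p. 455 L1–2] -/
theorem adelicTensorEnd_left_right_comm
    (A : SchwartzMap (Fin (n + n) → mixedEmbedding.mixedSpace F) ℂ →ₗ[ℂ] SchwartzMap (Fin (n + n) → mixedEmbedding.mixedSpace F) ℂ)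
    (B : FinSB F (Fin (n + n)) →ₗ[ℂ] FinSB F (Fin (n + n))) :
    adelicTensorEnd A LinearMap.id * adelicTensorEnd LinearMap.id B = adelicTensorEnd LinearMap.id B * adelicTensorEnd A LinearMap.id := by
  rw [← adelicTensorEnd_mul, ← adelicTensorEnd_mul]
  simp only [Module.End.mul_eq_comp, LinearMap.id_comp, LinearMap.comp_id]

end Literature.NumberTheory.GelbartRogawski1991.GRConstructionGen
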